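import Summits.Ventures.HSemireg.WedgeKunnethKernel

/-!
# Venture HSemireg — KERNEL–IMAGE DUALITY: `Kr(univ, f, k)` is the ANNIHILATOR of the image `V(univ, f, k′)` in the complementary degree
# (`k + deg f + k′ = |I|`) under the top-coefficient pairing — the kernel in one degree is NAMED by the image in the mirror degree

HONEST FRAMING. Part of the Lean index of the computation cell `pub-hsemireg` (seat p10 gen 15, Sunday typer «UNIFORM-IN-n»).
Finite-dimensional EXTERIOR ALGEBRA over a field ONLY: no variety, no cohomology theory, no sheaf, no Ext group and no
semiregularity map is constructed here; nothing here says that HC / HC_CM / HC_AV holds; no Literature fact is declared or used.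
Custodian versions cited: theory/FORMULA-N.md PART A §2.6 (THEOREM H), PART B §A.3 / PART D (th-7's duality of wedge RANKS,
`WedgeHankelDual.rank_cmat_dual` / `finrank_range_wedge_dual`: `rank(θ ↦ θ ∧ v ∣ ⋀^m) = rank(θ ↦ θ ∧ v ∣ ⋀^{m′})`, `m + d + m′ = |I|`);
STRUCTURE.md v1.0-SIGNED 9b196a05977dd067 §1.1 (row C4: the NAME of the kernel).  The dictionary (`⋀^k` on the generators ↔ `HT^k`;
`θ ↦ θ ∧ f` ↔ contraction against the class) is QUOTED from those files, never asserted.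

WHAT IS IN THE TREE.  th-7's PART D proves that the wedge RANKS of a homogeneous class agree in complementary degrees (a transpose of
coordinate matrices up to unit scalings).  The lineage (p10 gens 11–14) NAMES kernels degree by degree (`Kr(D, f, a)`, gen 13's
`WedgeKunnethKernel`): Siegel ideals, frame ideals, their intersections — all in the range `2k ≤ m` resp. `r ≤ min(k+1, m+1−k)`, the
mirror regime `k > m/2` being reached by NUMBER only (gen 14 `WedgeHankelTranspose`).  THIS FILE proves the missing NAME-LEVEL
duality, for EVERY finite generator set `I`, every field and every homogeneous class:
* §1 THE TOP-COEFFICIENT PAIRING IS PERFECT: `τ(x) :=` the coefficient of the volume monomial `E_univ`; a homogeneous `x` of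
  degree `a` with `τ(x ∧ E_U) = 0` for all `|U| = |I| − a` (resp. `τ(x ∧ η) = 0` for all `η ∈ Hom(univ, |I| − a)`, resp. `τ(η ∧ x) = 0`)
  is zero (`eq_zero_of_forall_top_mul_B`, `eq_zero_of_forall_top_mul`, `eq_zero_of_forall_top_mul_left`) — from th-7's entry lemma
  `coord_univ_mul_B_compl` (the structure constants are units, never evaluated).
* §2 ANNIHILATORS `Ann_k(W) := {θ ∈ Hom(univ, k) : τ(θ ∧ v) = 0 ∀ v ∈ W}` (`Ann`, antitone, `Ann_k(⊥) = Hom(univ,k)`) and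
  **THE KERNEL–IMAGE DUALITY `Kr_univ_eq_Ann`: for `f ∈ Hom(univ, d)` and `k + d + k′ = |I|`,
  `Kr(univ, f, k) = Ann_k(V(univ, f, k′))`** — a degree-`k` form kills `f` iff it pairs to zero with EVERY `E_S ∧ f`, `|S| = k′`
  (`mem_Kr_univ_iff_forall_top`); symmetrically `Kr(univ, f, k′) = Ann_{k′}(V(univ, f, k))` (`Kr_univ_eq_Ann'`).  So the kernel in a
  degree is DETERMINED BY (and determines) the image in the complementary degree: **`Kr_univ_eq_of_V_eq`: two homogeneous classes of
  the same degree with the same degree-`k′` image have the same degree-`k` kernel**, and `Kr_univ_mono_of_V_le` (bigger image, smaller kernel).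
* §3 NUMBERS: with gen 13's per-degree rank–nullity and th-7's rank duality, **`finrank_Ann_V_add`: `dim Ann_k(V(univ,f,k′)) + dim V(univ,f,k′)
  = C(|I|, k)`**, `finrank_Kr_univ_add_finrank_V_dual`: `dim Kr(univ,f,k) + r_{k′}(f) = C(|I|,k)`.
* §3b THE PAIRING IS PERFECT: via the dual coannihilator of the image of `W` under `v ↦ τ(· ∧ v)` (`pairR`, injective by §1),
  **`finrank_Ann_add`: `dim Ann_a(W) + dim W = C(|I|, a)` for EVERY `W ≤ Hom(univ, b)`, `a + b = |I|`**, the DOUBLE ANNIHILATOR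
  **`Ann_Ann`: `Ann_b(Ann_a(W)) = W`** and **`Ann_inf`: `Ann_a(W ⊓ W′) = Ann_a(W) ⊔ Ann_a(W′)`**; hence the converse naming
  **`V_univ_eq_Ann_Kr`: `V(univ, f, k′) = Ann_{k′+d}(Kr(univ, f, k))`** — the image in one degree is the annihilator of the kernel in the
  complementary degree (`V_univ_eq_of_Kr_eq`: equal kernels ⇒ equal mirror images; double annihilators `Ann_Ann_V`).
* §4 th-7's HANKEL MODEL (`I = Fin (m+m)`, `f = w_m(q) ∈ Hom(univ, m)`, `k + k′ = m`): **`Kr_w_eq_Ann`: `Kr(univ, w_m(q), k) =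
  Ann_k(V(univ, w_m(q), m − k))` for EVERY `q`** — in the MIRROR regime `k > m/2` the kernel of a `K[Θ]`-class is the annihilator of its
  image in the low degree `m − k < m/2`, where the lineage names images (gen 14 `WedgeHankelSecantImage`: direct sums of the exponentials'
  images); `Kr_w_eq_of_V_w_eq`: classes with equal low-degree images have equal mirror kernels; dually **`V_w_eq_Ann`**: the low-degree IMAGE of a
  `K[Θ]`-class is the annihilator of its mirror kernel (so gen 11–15's kernel names give image names for free).
NOT typed here: the explicit annihilators of the secant images (they follow from gen 14's image law by `Ann` of a sup = inf of `Ann`s, `Ann_sup`, once those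
files are in the tree); anything Ext-side.  Class side only.  Namespace `Summit.Ventures.HSemireg.Wedge.KernelDuality` (new); new names only.
-/

open Module

namespace Summit.Ventures.HSemireg.Wedge.KernelDuality

open Summit.Ventures.HSemireg.Wedge Summit.Ventures.HSemireg.Wedge.Kunneth Summit.Ventures.HSemireg.Wedge.KunnethKernel
  Summit.Ventures.HSemireg.Wedge.Hankel

variable (K : Type*) [Field K] {I : Type*} [LinearOrder I] [Fintype I]

/-! ## §1. The top-coefficient pairing is perfect -/

/-- the TOP COEFFICIENT `τ(x)`: the coordinate of the volume monomial `E_univ` in `x`. -/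
noncomputable def topCoeff : HT K I →ₗ[K] K := (B K I).coord Finset.univ

/-- `τ(x)` is the `E_univ`-coordinate (definitional). -/
lemma topCoeff_apply (x : HT K I) : topCoeff K x = (B K I).coord Finset.univ x := rfl

/-- `τ(x ∧ E_{Uᶜ}) = u(U,Uᶜ) · (coefficient of E_U in x)` for `x` homogeneous of degree `|U|` (th-7's entry lemma, restated for `τ`). -/
lemma topCoeff_mul_B_compl {k : ℕ} {x : HT K I} (hx : x ∈ Hom K I Finset.univ k) {U : Finset I} (hU : U.card = k) :
    topCoeff K (x * B K I Uᶜ) = u K U Uᶜ * (B K I).coord U x :=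
  coord_univ_mul_B_compl K hx hU

/-- **NON-DEGENERACY (monomial form)**: a homogeneous `x` of degree `a` with `τ(x ∧ E_U) = 0` for every `|U| = b`, `a + b = |I|`, is zero. -/
theorem eq_zero_of_forall_top_mul_B {a b : ℕ} (hab : a + b = Fintype.card I) {x : HT K I} (hx : x ∈ Hom K I Finset.univ a)
    (h : ∀ U : Finset I, U.card = b → topCoeff K (x * B K I U) = 0) : x = 0 := by
  apply eq_zero_of_coord_card K hx
  intro T hT
  have hTc : Tᶜ.card = b := by rw [Finset.card_compl, hT]; omega
  have h1 := h Tᶜ hTc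
  rw [topCoeff_mul_B_compl K hx hT] at h1
  rcases mul_eq_zero.mp h1 with h2 | h2
  · exact absurd h2 ((u_ne_zero_iff K).mpr disjoint_compl_right)
  · exact h2

/-- **NON-DEGENERACY**: a homogeneous `x` of degree `a` with `τ(x ∧ η) = 0` for every `η ∈ Hom(univ, b)`, `a + b = |I|`, is zero. -/
theorem eq_zero_of_forall_top_mul {a b : ℕ} (hab : a + b = Fintype.card I) {x : HT K I} (hx : x ∈ Hom K I Finset.univ a)
    (h : ∀ η ∈ Hom K I Finset.univ b, topCoeff K (x * η) = 0) : x = 0 :=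
  eq_zero_of_forall_top_mul_B K hab hx fun U hU => h _ (B_mem_Hom K (Finset.subset_univ U) hU)

/-- **NON-DEGENERACY on the other side**: a homogeneous `x` of degree `b` with `τ(η ∧ x) = 0` for every `η ∈ Hom(univ, a)`, `a + b = |I|`,
is zero (monomials commute past `x` up to a sign). -/
theorem eq_zero_of_forall_top_mul_left {a b : ℕ} (hab : a + b = Fintype.card I) {x : HT K I} (hx : x ∈ Hom K I Finset.univ b)
    (h : ∀ η ∈ Hom K I Finset.univ a, topCoeff K (η * x) = 0) : x = 0 := by
  refine eq_zero_of_forall_top_mul_B K (show b + a = Fintype.card I by omega) hx fun U hU => ?_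
  have h1 := h _ (B_mem_Hom K (Finset.subset_univ U) hU)
  rw [B_mul_comm_of_mem_Hom K hx U, map_smul, smul_eq_mul] at h1
  rcases mul_eq_zero.mp h1 with h2 | h2
  · exact absurd h2 (pow_ne_zero _ (neg_ne_zero.mpr one_ne_zero))
  · exact h2

/-! ## §2. Annihilators, and the kernel as the annihilator of the mirror image -/

/-- **the degree-`k` ANNIHILATOR** of a subspace `W` under the top-coefficient pairing:
`Ann_k(W) := {θ ∈ Hom(univ, k) : τ(θ ∧ v) = 0 for all v ∈ W}`. -/
noncomputable def Ann (k : ℕ) (W : Submodule K (HT K I)) : Submodule K (HT K I) :=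
  Hom K I Finset.univ k ⊓ ⨅ v ∈ W, LinearMap.ker (topCoeff K ∘ₗ LinearMap.mulRight K v)

variable {K} in
/-- membership in an annihilator. -/
lemma mem_Ann {k : ℕ} {W : Submodule K (HT K I)} {θ : HT K I} :
    θ ∈ Ann K k W ↔ θ ∈ Hom K I Finset.univ k ∧ ∀ v ∈ W, topCoeff K (θ * v) = 0 := by
  rw [Ann, Submodule.mem_inf]
  refine and_congr_right fun _ => ?_
  simp only [Submodule.mem_iInf, LinearMap.mem_ker, LinearMap.comp_apply, LinearMap.mulRight_apply]

/-- `Ann_k(W) ≤ Hom(univ, k)`. -/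
lemma Ann_le_Hom (k : ℕ) (W : Submodule K (HT K I)) : Ann K k W ≤ Hom K I Finset.univ k := inf_le_left

/-- annihilators are ANTITONE: `W ≤ W′ ⇒ Ann_k(W′) ≤ Ann_k(W)`. -/
lemma Ann_anti (k : ℕ) {W W' : Submodule K (HT K I)} (h : W ≤ W') : Ann K k W' ≤ Ann K k W := fun _ hθ =>
  mem_Ann.mpr ⟨(mem_Ann.mp hθ).1, fun v hv => (mem_Ann.mp hθ).2 v (h hv)⟩

/-- `Ann_k(⊥) = Hom(univ, k)`. -/
lemma Ann_bot (k : ℕ) : Ann K k (⊥ : Submodule K (HT K I)) = Hom K I Finset.univ k := by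
  refine le_antisymm (Ann_le_Hom K k ⊥) fun θ hθ => mem_Ann.mpr ⟨hθ, fun v hv => ?_⟩
  rw [(Submodule.mem_bot K).mp hv, mul_zero, map_zero]

/-- `Ann_k(W ⊔ W′) = Ann_k(W) ⊓ Ann_k(W′)`: the annihilator of a sum is the intersection of the annihilators. -/
theorem Ann_sup (k : ℕ) (W W' : Submodule K (HT K I)) : Ann K k (W ⊔ W') = Ann K k W ⊓ Ann K k W' := by
  refine le_antisymm (le_inf (Ann_anti K k le_sup_left) (Ann_anti K k le_sup_right)) fun θ hθ => ?_
  rw [Submodule.mem_inf] at hθ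
  refine mem_Ann.mpr ⟨(mem_Ann.mp hθ.1).1, fun v hv => ?_⟩
  obtain ⟨y, hy, z, hz, rfl⟩ := Submodule.mem_sup.mp hv
  rw [mul_add, map_add, (mem_Ann.mp hθ.1).2 y hy, (mem_Ann.mp hθ.2).2 z hz, add_zero]

/-- `Ann_k(⨆_i W_i) = ⨅_i Ann_k(W_i)` over a finite nonempty index type… stated for `Fin (r+1)`-indexed families by induction-free means:
membership form valid for ANY index type. -/
theorem mem_Ann_iSup_iff {ι : Type*} (k : ℕ) (W : ι → Submodule K (HT K I)) {θ : HT K I} :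
    θ ∈ Ann K k (⨆ i, W i) ↔ θ ∈ Hom K I Finset.univ k ∧ ∀ i, ∀ v ∈ W i, topCoeff K (θ * v) = 0 := by
  rw [mem_Ann]
  refine and_congr_right fun _ => ⟨fun h i v hv => h v (Submodule.mem_iSup_of_mem i hv), fun h v hv => ?_⟩
  induction hv using Submodule.iSup_induction' with
  | mem i x hx => exact h i x hx
  | zero => rw [mul_zero, map_zero]
  | add x y _ _ hx hy => rw [mul_add, map_add, hx, hy, add_zero]

/-- **A FORM KILLS `f` IFF IT PAIRS TO ZERO WITH EVERY `f ∧ E_U` OF COMPLEMENTARY DEGREE**: for `f ∈ Hom(univ, d)`, `k + d + k′ = |I|`,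
`θ ∈ Kr(univ, f, k) ⟺ θ ∈ Hom(univ, k) ∧ ∀ |U| = k′, τ(θ ∧ f ∧ E_U) = 0`. -/
theorem mem_Kr_univ_iff_forall_top {d k k' : ℕ} (h : k + d + k' = Fintype.card I) {f : HT K I}
    (hf : f ∈ Hom K I Finset.univ d) {θ : HT K I} :
    θ ∈ Kr K Finset.univ f k ↔ θ ∈ Hom K I Finset.univ k ∧ ∀ U : Finset I, U.card = k' → topCoeff K (θ * f * B K I U) = 0 := by
  rw [mem_Kr]
  refine ⟨fun hθ => ⟨hθ.1, fun U _ => by rw [hθ.2, zero_mul, map_zero]⟩, fun hθ => ⟨hθ.1, ?_⟩⟩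
  exact eq_zero_of_forall_top_mul_B K (show (k + d) + k' = Fintype.card I by omega) (Wedge.mul_mem_Hom K hθ.1 hf) hθ.2

/-- **THE KERNEL–IMAGE DUALITY: `Kr(univ, f, k) = Ann_k(V(univ, f, k′))`** for `f ∈ Hom(univ, d)` and `k + d + k′ = |I|` — the degree-`k`
forms killing `f` are exactly those pairing to zero with the IMAGE of `θ′ ↦ θ′ ∧ f` in the complementary degree `k′`. -/
theorem Kr_univ_eq_Ann {d k k' : ℕ} (h : k + d + k' = Fintype.card I) {f : HT K I} (hf : f ∈ Hom K I Finset.univ d) :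
    Kr K Finset.univ f k = Ann K k (V K I Finset.univ f k') := by
  ext θ
  rw [mem_Kr_univ_iff_forall_top K h hf, mem_Ann]
  refine and_congr_right fun hθ => ⟨fun h0 v hv => ?_, fun h0 U hU => ?_⟩
  · rw [V] at hv
    induction hv using Submodule.span_induction with
    | mem x hx =>
      obtain ⟨s, ⟨-, hs⟩, rfl⟩ := hx
      show topCoeff K (θ * (B K I s * f)) = 0
      rw [B_mul_comm_of_mem_Hom K hf s, mul_smul_comm, map_smul, ← mul_assoc, h0 s hs, smul_zero]
    | zero => rw [mul_zero, map_zero]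
    | add x y _ _ hx hy => rw [mul_add, map_add, hx, hy, add_zero]
    | smul a x _ hx => rw [mul_smul_comm, map_smul, hx, smul_zero]
  · have hmem : B K I U * f ∈ V K I Finset.univ f k' := Submodule.subset_span ⟨U, ⟨Finset.subset_univ _, hU⟩, rfl⟩
    have h1 := h0 _ hmem
    rw [B_mul_comm_of_mem_Hom K hf U, mul_smul_comm, map_smul, ← mul_assoc, smul_eq_mul] at h1
    rcases mul_eq_zero.mp h1 with h2 | h2
    · exact absurd h2 (pow_ne_zero _ (neg_ne_zero.mpr one_ne_zero))
    · exact h2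

/-- the same duality read from the other degree: **`Kr(univ, f, k′) = Ann_{k′}(V(univ, f, k))`**. -/
theorem Kr_univ_eq_Ann' {d k k' : ℕ} (h : k + d + k' = Fintype.card I) {f : HT K I} (hf : f ∈ Hom K I Finset.univ d) :
    Kr K Finset.univ f k' = Ann K k' (V K I Finset.univ f k) :=
  Kr_univ_eq_Ann K (show k' + d + k = Fintype.card I by omega) hf

/-- **THE IMAGE IN ONE DEGREE DETERMINES THE KERNEL IN THE COMPLEMENTARY DEGREE**: homogeneous `f, g` of the same degree `d` with
`V(univ, f, k′) = V(univ, g, k′)` have `Kr(univ, f, k) = Kr(univ, g, k)` (`k + d + k′ = |I|`). -/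
theorem Kr_univ_eq_of_V_eq {d k k' : ℕ} (h : k + d + k' = Fintype.card I) {f g : HT K I} (hf : f ∈ Hom K I Finset.univ d)
    (hg : g ∈ Hom K I Finset.univ d) (hV : V K I Finset.univ f k' = V K I Finset.univ g k') :
    Kr K Finset.univ f k = Kr K Finset.univ g k := by
  rw [Kr_univ_eq_Ann K h hf, Kr_univ_eq_Ann K h hg, hV]

/-- BIGGER IMAGE, SMALLER KERNEL: `V(univ, f, k′) ≤ V(univ, g, k′) ⇒ Kr(univ, g, k) ≤ Kr(univ, f, k)`. -/
theorem Kr_univ_mono_of_V_le {d k k' : ℕ} (h : k + d + k' = Fintype.card I) {f g : HT K I} (hf : f ∈ Hom K I Finset.univ d)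
    (hg : g ∈ Hom K I Finset.univ d) (hV : V K I Finset.univ f k' ≤ V K I Finset.univ g k') :
    Kr K Finset.univ g k ≤ Kr K Finset.univ f k := by
  rw [Kr_univ_eq_Ann K h hf, Kr_univ_eq_Ann K h hg]
  exact Ann_anti K k hV

/-- a kernel is contained in the annihilator of ANY sub-image: `W ≤ V(univ, f, k′) ⇒ Kr(univ, f, k) ≤ Ann_k(W)`. -/
lemma Kr_univ_le_Ann_of_le {d k k' : ℕ} (h : k + d + k' = Fintype.card I) {f : HT K I} (hf : f ∈ Hom K I Finset.univ d)
    {W : Submodule K (HT K I)} (hW : W ≤ V K I Finset.univ f k') : Kr K Finset.univ f k ≤ Ann K k W := by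
  rw [Kr_univ_eq_Ann K h hf]
  exact Ann_anti K k hW

/-! ## §3. Numbers: the annihilator of an image has the complementary dimension -/

/-- th-7's RANK DUALITY for any generator type: `r_k(f) = r_{k′}(f)` for `f ∈ Hom(univ, d)`, `k + d + k′ = |I|`. -/
theorem finrank_V_univ_dual {d k k' : ℕ} (h : k + d + k' = Fintype.card I) {f : HT K I} (hf : f ∈ Hom K I Finset.univ d) :
    finrank K (V K I Finset.univ f k) = finrank K (V K I Finset.univ f k') := by
  rw [V_eq_map, V_eq_map, ← rank_cmat K f hf k, ← rank_cmat K f hf k', rank_cmat_dual K h hf]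

/-- **`dim Kr(univ, f, k) + r_{k′}(f) = C(|I|, k)`** (`k + d + k′ = |I|`): rank–nullity in degree `k` with the rank read in the mirror degree. -/
theorem finrank_Kr_univ_add_finrank_V_dual {d k k' : ℕ} (h : k + d + k' = Fintype.card I) {f : HT K I}
    (hf : f ∈ Hom K I Finset.univ d) :
    finrank K (Kr K Finset.univ f k) + finrank K (V K I Finset.univ f k') = (Fintype.card I).choose k := by
  rw [← finrank_V_univ_dual K h hf, finrank_Kr_add_finrank_V, Finset.card_univ]

/-- **`dim Ann_k(V(univ, f, k′)) + dim V(univ, f, k′) = C(|I|, k)`**: the annihilator of an IMAGE has exactly the complementary dimension —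
the top-coefficient pairing between `Hom(univ, k)` and the degree-`k′` image of `f` is perfect on the quotient. -/
theorem finrank_Ann_V_add {d k k' : ℕ} (h : k + d + k' = Fintype.card I) {f : HT K I} (hf : f ∈ Hom K I Finset.univ d) :
    finrank K (Ann K k (V K I Finset.univ f k')) + finrank K (V K I Finset.univ f k') = (Fintype.card I).choose k := by
  rw [← Kr_univ_eq_Ann K h hf, finrank_Kr_univ_add_finrank_V_dual K h hf]


/-! ## §3b. The pairing is perfect: `dim Ann_a(W) + dim W = C(|I|, a)` for every `W ≤ Hom(univ, b)`, and images are annihilators of kernels -/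

/-- the bilinear pairing `(θ, v) ↦ τ(θ ∧ v)`. -/
noncomputable def pairing : HT K I →ₗ[K] HT K I →ₗ[K] K := (LinearMap.mul K (HT K I)).compr₂ (topCoeff K)

/-- the pairing evaluates to the top coefficient of the product (definitional). -/
lemma pairing_apply (θ v : HT K I) : pairing K θ v = topCoeff K (θ * v) := rfl

/-- `v ↦ (θ ↦ τ(θ ∧ v))`, as a map to the dual of `Hom(univ, a)`. -/
noncomputable def pairR (a : ℕ) : HT K I →ₗ[K] Module.Dual K (Hom K I Finset.univ a) :=
  LinearMap.domRestrict' (Hom K I Finset.univ a) ∘ₗ (pairing K).flip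

/-- evaluation of `pairR`. -/
lemma pairR_apply (a : ℕ) (v : HT K I) (θ : Hom K I Finset.univ a) : pairR K a v θ = topCoeff K ((θ : HT K I) * v) := rfl

/-- `dim Hom(univ, a) = C(|I|, a)`. -/
lemma finrank_Hom_univ (a : ℕ) : finrank K (Hom K I Finset.univ a) = (Fintype.card I).choose a := by
  rw [Hom_univ_eq_exteriorPower, exteriorPower.finrank_eq, finrank_fintype_fun_eq_card]

/-- the annihilator, pulled back to `Hom(univ, a)`, is the dual coannihilator of the image of `W` under `pairR`. -/
lemma comap_Ann_eq (a : ℕ) (W : Submodule K (HT K I)) :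
    (Ann K a W).comap (Hom K I Finset.univ a).subtype = (W.map (pairR K a)).dualCoannihilator := by
  ext θ
  rw [Submodule.mem_comap, Submodule.subtype_apply, mem_Ann, Submodule.mem_dualCoannihilator]
  constructor
  · rintro ⟨-, h⟩ φ hφ
    obtain ⟨v, hv, rfl⟩ := Submodule.mem_map.mp hφ
    rw [pairR_apply]; exact h v hv
  · intro h
    exact ⟨θ.2, fun v hv => h _ (Submodule.mem_map_of_mem hv)⟩

/-- **THE PAIRING IS PERFECT: `dim Ann_a(W) + dim W = C(|I|, a)` for every subspace `W ≤ Hom(univ, b)`, `a + b = |I|`.** -/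
theorem finrank_Ann_add {a b : ℕ} (hab : a + b = Fintype.card I) {W : Submodule K (HT K I)} (hW : W ≤ Hom K I Finset.univ b) :
    finrank K (Ann K a W) + finrank K W = (Fintype.card I).choose a := by
  have h1 : finrank K (W.map (pairR K a)) = finrank K W := by
    refine finrank_map_of_injOn K (pairR K a) W fun v hv h0 => ?_
    refine eq_zero_of_forall_top_mul_left K hab (hW hv) fun η hη => ?_
    have := LinearMap.congr_fun h0 ⟨η, hη⟩
    rwa [pairR_apply, LinearMap.zero_apply] at this
  have h2 := Subspace.finrank_add_finrank_dualCoannihilator_eq (W.map (pairR K a))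
  rw [h1, ← comap_Ann_eq, (Submodule.comapSubtypeEquivOfLe (Ann_le_Hom K a W)).finrank_eq, finrank_Hom_univ] at h2
  omega


/-- `W ≤ Ann_b(Ann_a(W))` for `W ≤ Hom(univ, b)`: a class pairs to zero with everything that pairs to zero with it (the pairing is symmetric up to the sign
`(−1)^{ab}` on homogeneous classes). -/
lemma le_Ann_Ann {a b : ℕ} {W : Submodule K (HT K I)} (hW : W ≤ Hom K I Finset.univ b) : W ≤ Ann K b (Ann K a W) := by
  intro w hw
  refine mem_Ann.mpr ⟨hW hw, fun θ hθ => ?_⟩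
  obtain ⟨hθk, h0⟩ := mem_Ann.mp hθ
  rw [mul_comm_Hom K (hW hw) hθk, map_smul, h0 w hw, smul_zero]

/-- **DOUBLE ANNIHILATOR: `Ann_b(Ann_a(W)) = W`** for every subspace `W ≤ Hom(univ, b)`, `a + b = |I|` (perfect pairing: both sides have dimension `dim W`). -/
theorem Ann_Ann {a b : ℕ} (hab : a + b = Fintype.card I) {W : Submodule K (HT K I)} (hW : W ≤ Hom K I Finset.univ b) :
    Ann K b (Ann K a W) = W := by
  symm
  apply Submodule.eq_of_le_of_finrank_eq (le_Ann_Ann K hW)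
  have h1 := finrank_Ann_add K hab hW
  have h2 := finrank_Ann_add K (a := b) (b := a) (by omega) (Ann_le_Hom K a W)
  have h3 : (Fintype.card I).choose b = (Fintype.card I).choose a := by
    rw [show b = Fintype.card I - a by omega, Nat.choose_symm (by omega)]
  omega

/-- **the annihilator of an INTERSECTION is the SUM of the annihilators: `Ann_a(W ⊓ W′) = Ann_a(W) ⊔ Ann_a(W′)`** for `W, W′ ≤ Hom(univ, b)`, `a + b = |I|`
(by the double annihilator and `Ann_sup`). -/
theorem Ann_inf {a b : ℕ} (hab : a + b = Fintype.card I) {W W' : Submodule K (HT K I)} (hW : W ≤ Hom K I Finset.univ b)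
    (hW' : W' ≤ Hom K I Finset.univ b) : Ann K a (W ⊓ W') = Ann K a W ⊔ Ann K a W' := by
  have hba : b + a = Fintype.card I := by omega
  have key : Ann K b (Ann K a W ⊔ Ann K a W') = W ⊓ W' := by
    rw [Ann_sup, Ann_Ann K hab hW, Ann_Ann K hab hW']
  rw [← key, Ann_Ann K hba (sup_le (Ann_le_Hom K a W) (Ann_le_Hom K a W'))]

/-- the image lies in the annihilator of the kernel: `V(univ, f, k′) ≤ Ann_{k′+d}(Kr(univ, f, k))` (`θ ∧ f = 0 ⇒ τ((E_s ∧ f) ∧ θ) = ±τ(E_s ∧ (θ ∧ f)) = 0`). -/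
lemma V_univ_le_Ann_Kr {d k k' : ℕ} {f : HT K I} (hf : f ∈ Hom K I Finset.univ d) :
    V K I Finset.univ f k' ≤ Ann K (k' + d) (Kr K Finset.univ f k) := by
  intro v hv
  refine mem_Ann.mpr ⟨V_le_Hom K hf k' hv, fun θ hθ => ?_⟩
  obtain ⟨hθk, h0⟩ := mem_Kr.mp hθ
  rw [V] at hv
  induction hv using Submodule.span_induction with
  | mem x hx =>
    obtain ⟨s, ⟨-, -⟩, rfl⟩ := hx
    rw [mul_assoc, mul_comm_Hom K hf hθk, h0, smul_zero, mul_zero, map_zero]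
  | zero => rw [zero_mul, map_zero]
  | add x y _ _ hx hy => rw [add_mul, map_add, hx, hy, add_zero]
  | smul c x _ hx => rw [smul_mul_assoc, map_smul, hx, smul_zero]

/-- **THE IMAGE IS THE ANNIHILATOR OF THE KERNEL: `V(univ, f, k′) = Ann_{k′+d}(Kr(univ, f, k))`** for `f ∈ Hom(univ, d)`, `k + d + k′ = |I|` — the
duality of §2 read the other way (by the perfect pairing and the rank duality, the dimensions agree). -/
theorem V_univ_eq_Ann_Kr {d k k' : ℕ} (h : k + d + k' = Fintype.card I) {f : HT K I} (hf : f ∈ Hom K I Finset.univ d) :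
    V K I Finset.univ f k' = Ann K (k' + d) (Kr K Finset.univ f k) := by
  apply Submodule.eq_of_le_of_finrank_eq (V_univ_le_Ann_Kr K hf)
  have h1 := finrank_Ann_add K (a := k' + d) (b := k) (by omega) (Kr_le_Hom K Finset.univ f k)
  have h2 := finrank_Kr_univ_add_finrank_V_dual K h hf
  have h3 : (Fintype.card I).choose (k' + d) = (Fintype.card I).choose k := by
    rw [show k' + d = Fintype.card I - k by omega, Nat.choose_symm (by omega)]
  omega

/-- so **THE KERNEL IN ONE DEGREE DETERMINES THE IMAGE IN THE COMPLEMENTARY DEGREE** as well: equal kernels ⇒ equal images. -/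
theorem V_univ_eq_of_Kr_eq {d k k' : ℕ} (h : k + d + k' = Fintype.card I) {f g : HT K I} (hf : f ∈ Hom K I Finset.univ d)
    (hg : g ∈ Hom K I Finset.univ d) (hK : Kr K Finset.univ f k = Kr K Finset.univ g k) :
    V K I Finset.univ f k' = V K I Finset.univ g k' := by
  rw [V_univ_eq_Ann_Kr K h hf, V_univ_eq_Ann_Kr K h hg, hK]

/-- **DOUBLE ANNIHILATOR on images and kernels**: `Ann_{k′+d}(Ann_k(V(univ,f,k′))) = V(univ,f,k′)` and `Ann_k(Ann_{k′+d}(Kr(univ,f,k))) = Kr(univ,f,k)`. -/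
theorem Ann_Ann_V {d k k' : ℕ} (h : k + d + k' = Fintype.card I) {f : HT K I} (hf : f ∈ Hom K I Finset.univ d) :
    Ann K (k' + d) (Ann K k (V K I Finset.univ f k')) = V K I Finset.univ f k' ∧
      Ann K k (Ann K (k' + d) (Kr K Finset.univ f k)) = Kr K Finset.univ f k := by
  constructor
  · rw [← Kr_univ_eq_Ann K h hf]; exact (V_univ_eq_Ann_Kr K h hf).symm
  · rw [← V_univ_eq_Ann_Kr K h hf]; exact (Kr_univ_eq_Ann K h hf).symm

/-! ## §4. th-7's Hankel model: the mirror-regime kernel of a `K[Θ]`-class is the annihilator of its low-degree image -/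

/-- **`Kr(univ, w_m(q), k) = Ann_k(V(univ, w_m(q), k′))` for EVERY sequence `q` and `k + k′ = m`** (th-7's model on `Fin (m+m)`):
the degree-`k` kernel of a `K[Θ]`-class is the annihilator of its image in the complementary degree `m − k`. -/
theorem Kr_w_eq_Ann {m k k' : ℕ} (h : k + k' = m) (q : ℕ → K) :
    Kr K Finset.univ (w K m m q) k = Ann K k (V K (In m) Finset.univ (w K m m q) k') :=
  Kr_univ_eq_Ann K (d := m) (k := k) (k' := k') (by rw [Fintype.card_fin]; omega)
    (by simpa only [Dm_top] using w_mem_Hom K le_rfl q)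

/-- **EQUAL LOW-DEGREE IMAGES ⇒ EQUAL MIRROR KERNELS**: `V(univ, w_m(q), k′) = V(univ, w_m(q′), k′) ⇒ Kr(univ, w_m(q), k) = Kr(univ, w_m(q′), k)`
(`k + k′ = m`). -/
theorem Kr_w_eq_of_V_w_eq {m k k' : ℕ} (h : k + k' = m) {q q' : ℕ → K}
    (hV : V K (In m) Finset.univ (w K m m q) k' = V K (In m) Finset.univ (w K m m q') k') :
    Kr K Finset.univ (w K m m q) k = Kr K Finset.univ (w K m m q') k := by
  rw [Kr_w_eq_Ann K h, Kr_w_eq_Ann K h, hV]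

/-- the mirror-degree kernel NUMBER of a `K[Θ]`-class from its low-degree rank: `dim Kr(univ, w_m(q), k) + r_{k′}(w_m(q)) = C(2m, k)`, `k + k′ = m`. -/
theorem finrank_Kr_w_add {m k k' : ℕ} (h : k + k' = m) (q : ℕ → K) :
    finrank K (Kr K Finset.univ (w K m m q) k) + finrank K (V K (In m) Finset.univ (w K m m q) k') = (m + m).choose k := by
  have := finrank_Kr_univ_add_finrank_V_dual K (k := k) (d := m) (k' := k') (I := In m) (by rw [Fintype.card_fin]; omega)
    (by simpa only [Dm_top] using w_mem_Hom K le_rfl q)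
  rwa [Fintype.card_fin] at this

/-- **`V(univ, w_m(q), k′) = Ann_{k′+m}(Kr(univ, w_m(q), k))`** (`k + k′ = m`): the low-degree image of a `K[Θ]`-class is the annihilator of its mirror kernel. -/
theorem V_w_eq_Ann {m k k' : ℕ} (h : k + k' = m) (q : ℕ → K) :
    V K (In m) Finset.univ (w K m m q) k' = Ann K (k' + m) (Kr K Finset.univ (w K m m q) k) :=
  V_univ_eq_Ann_Kr K (d := m) (k := k) (k' := k') (by rw [Fintype.card_fin]; omega)
    (by simpa only [Dm_top] using w_mem_Hom K le_rfl q)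

end Summit.Ventures.HSemireg.Wedge.KernelDuality
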